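import Summits.QuantumFields.YangMills.Theorems.BalabanUVNodesK2V6Defs
import Literature.MathematicalPhysics.QuantumFieldTheory.Balaban1983to89.Beta.RemainderChain
import Mathlib.Analysis.Normed.Group.Tannery

/-!
# Idea-5 g9 sketch — EDITION 2 of «two-bound activity interpolation» for crux K2⁷ `EndpointGivenBR13SepCoPH`
# (stmt-QuantumFields-20543), stub 2ᴮ″ `RunRemAtSomeJets` of skeleton v6 (5a75a2378c79b303): the MODULUS SOCKET once,
# and the card's content as a PINNED activity representation (answer to CRIT-2 TRIAGE T1 ∕ V2 ∕ CF4)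

Cell `ym-nodeO-ideate`, IDEATOR seat `ym-nodeO-idea-5` gen 9 (planner-ym-nodeO-idea-5-g9-0), lens «obstruction-first».
Companion of EDITION 2 of the crux idea card `Ideas/two-bound-activity-interpolation.md` and of the desk memo
`DESK-CF1-two-bound-idea5g9.md`; supersedes the TYPING (not the engine) of the g8 sketch `Idea5g8TwoBoundSketch.lean` (bae1bbf29ee8).

HONEST FRAMING.  Nothing here proves the Yang–Mills mass gap (Clay) or any rung of it.  Route R4 `BalabanUVNodes` closes only the
CONDITIONAL finite-𝕋⁴ rung `BalabanLadder.UV`; NODE O = [Balaban1987RG1] Thm 2 ∕ (0.31) p. 259 is UNPROVED in print; K2⁷ stays OPEN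
(v6: 2 registered stubs, 0 closed).  PROVED below: elementary real analysis and by-name bookkeeping into the registered stub text and the
crux decl.  DEFINED below: HYPOTHESIS SHAPES (`RunModulus`, `ModulusAtAnchoredJets13`, `AnchorSurvSomeJets13`, the pinned variants) and an
INTERFACE (`ActivityRepr`, `RecordRepr13`, `LinOnRuns`, `LinAtAnchoredJets13`, `ChainDominated`) — obligation texts and the TYPE of a
definer-first deliverable; none is asserted, no instance of the interface at the record is constructed here (that is debt h1, item D-REPR).

WHAT CHANGED AGAINST g8, AND WHY (CRIT-2 TRIAGE `CRIT-2-TRIAGE-two-bound-activity-interpolation.md`, probe `Crit2Idea5g8Probe.lean` cde9179877b94d75):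
* T1 (costume of the ∃ι-letter — AGREED).  The critic's `runDominatedSplit_of_runModulus` shows g8's `RunDominatedSplit` (family EXISTENTIAL) ⟺ the
  plain modulus letter on a window.  So §1 adopts the critic's `RunModulus` text VERBATIM as THE letter and `ModulusAtAnchoredJets13` as THE ONE socket
  text to register for all 2ᴮ″ modulus suppliers (peel ed.2 ∕ convex-fibre ed.2.3 ∕ this card), with the ★∕★★ roads BY NAME (§1); the card's OWN content
  moves to §3: a representation `R : ActivityRepr β b γ₀` whose index is PINNED to the k-free type `LocDomainZ4` of unit-lattice localization domains
  of ℤ⁴ and whose terms `R.I X` and frozen majorants `R.M X` are FIELDS of a NAMED structure — so S-LIN = `LinOnRuns R` is a statement ABOUT A GIVEN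
  FAMILY, not an existential.  §3 proves (i) `runModulus_of_linOnRuns` (Tannery: S-LIN on any representation ⟹ the modulus letter) and (ii) the
  ANTI-COSTUME fact `exists_repr_modulus_not_lin`: for a pinned family, S-LIN is NOT implied by the modulus (two cancelling `±√g` terms) — the exact
  sense in which pinning restores content the ∃ι-letter forgot.  The record's intended instance `activityReprOfRecord₁₃ : RecordRepr13` (§4: `I X :=`
  the X-term of print's localized β¹ through `secondMoment ∘ polLimit`, `M X :=` the `RemainderChain` constants, shape `ChainDominated`) is a
  DEFINITION ITEM (D-REPR, definer-first, h1) — a line may register `stub_linOnRuns13 : LinAtAnchoredJets13 activityReprOfRecord₁₃` only AFTER it lands;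
  before that the only registrable 2ᴮ″-supplier socket is S-MOD, shared.
* V2 (hidden per-scale identification — AGREED, not new).  `HasSum` to `β_k − θ.cβ·b_k(κ)` with termwise vanishing forces the g-independent offset to
  vanish, i.e. the representation exists only at an ANCHORING κ: every §1∕§4 text carries `ScaleAnchor … (fun k => θ.cβ * beta0OfJs F κ k)` as a
  HYPOTHESIS (as g8's (DS) did), keyed to the same κ as (AS); two anchoring data have the same scaled numbers (tree `ScaleAnchor.eq_of_smul`), so no pin
  beyond ROUND 4's (P6) question is introduced; the κ⋆-PINNED variants (§1 `…AtPin13`, ★★ₚ through the tree's `EndpointGivenBR13SepCoPH_of_pin`) are offered.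
* CF4 (index AFTER `polLimit` — ADOPTED).  `LocDomainZ4 := Finset (Fin 4 → ℤ)` is k- and volume-FREE (Tannery-ready); a torus-indexed family
  `(Sn n).Dom` (tree `RemainderChain.PolLeaves`) would not be.  The termwise T ↗ ℤ⁴ limits are part of D-REPR (h1; cell GAPS G-adv2-2).

Sources: [I] = [Balaban1987RG1] CMP 109 (1987) Thm 2 p. 259, (1.20)–(1.22) p. 264, (2.12)–(2.15) p. 268, (0.29) p. 258; [II] = [Balaban1988RG2Cluster]
CMP 116 (1988) (1.20) p. 6, p. 8 L23–25, (1.38)–(1.40) p. 10, (2.15) p. 15, (2.18)–(2.22) p. 16, Lemma 3 (2.38) + definition of C₃ p. 20, (2.41) p. 21;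
tree: `Beta.RemainderChain` (`remActivity`, `PolLeaves`, `Chain`), p596574 `…K2NamedJetsRunRemAt`, p593586 `…K2NamedJetsRemAt`, p588621 `…K2JsOfRecord`,
p603331∕p606356 `…K2V6Defs` (v1.1 §4 pinned keying); crux workfiles `Idea5g8TwoBoundSketch.lean` (engine), `Crit2Idea5g8Probe.lean` (`RunModulus`, T1);
Mathlib `tendsto_tsum_of_dominated_convergence`.
-/

noncomputable section

namespace Summit.QuantumFields.YangMills.Cruxes.EndpointGivenBR13SepCoPH.Idea5g9

open Filter Topology
open Literature.MathematicalPhysics.QuantumFieldTheory.Balaban1983to89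
open Literature.MathematicalPhysics.QuantumFieldTheory.Balaban1983to89.FlowStep
open Literature.MathematicalPhysics.QuantumFieldTheory.Balaban1983to89.T4Continuum (T4Family)
open Literature.MathematicalPhysics.QuantumFieldTheory.Balaban1983to89.Beta.Drift (OneLoopDrift)
open Literature.MathematicalPhysics.QuantumFieldTheory.Balaban1983to89.Beta.RemainderChain (remActivity)
open Summit.QuantumFields.YangMills.Theorems.BalabanUVNodesK2JsOfRecord (StepColourData beta0OfJs stepBal_L_pos)
open Summit.QuantumFields.YangMills.Theorems.BalabanUVNodesK2NamedJetsRemAt (ScaleAnchor)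
open Summit.QuantumFields.YangMills.Theorems.BalabanUVNodesK2NamedJetsRunRemAt (RunRemAt RunConstRemainder SurvCont)
open Summit.QuantumFields.YangMills.Theorems.BalabanUVNodesK2V6Defs (Window13 RunRemAtSomeJets D1AtAnchoredJets
  EndpointGivenBR13SepCoPH_of_stubTexts EndpointGivenBR13SepCoPH_of_pin)

/-! ## §0 ENGINE (copied from the g8 sketch §1, crux workfiles not being importable) — the Tannery modulus `ω(g) = Σ' min(A_i g, M_i)` -/

variable {ι : Type*}

/-- The two-bound interpolation modulus `ω(g) := Σ'_i min(A_i·g, M_i)`. [folklore] -/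
def omegaMin (A M : ι → ℝ) (g : ℝ) : ℝ := ∑' i, min (A i * g) (M i)

theorem min_nonneg_of {A M : ι → ℝ} (hA : ∀ i, 0 ≤ A i) (hM : ∀ i, 0 ≤ M i) {g : ℝ} (hg : 0 ≤ g) (i : ι) :
    0 ≤ min (A i * g) (M i) :=
  le_min (mul_nonneg (hA i) hg) (hM i)

/-- **THE ENGINE (Tannery): `ω(g) → 0` as `g → 0⁺`** — summable frozen majorants + termwise vanishing, NO rate and NO
summability asked of the vanishing constants `A_i`. [folklore] -/
theorem tendsto_omegaMin {A M : ι → ℝ} (hA : ∀ i, 0 ≤ A i) (hM : ∀ i, 0 ≤ M i) (hsum : Summable M) :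
    Tendsto (omegaMin A M) (𝓝[>] 0) (𝓝 0) := by
  have hlim : ∀ i, Tendsto (fun g : ℝ => min (A i * g) (M i)) (𝓝[>] 0) (𝓝 (min (A i * 0) (M i))) := by
    intro i
    have hc : Continuous fun g : ℝ => min (A i * g) (M i) :=
      (continuous_const.mul continuous_id).min continuous_const
    exact (hc.tendsto 0).mono_left nhdsWithin_le_nhds
  have hbd : ∀ᶠ g in 𝓝[>] (0 : ℝ), ∀ i, ‖min (A i * g) (M i)‖ ≤ M i := by
    filter_upwards [self_mem_nhdsWithin] with g hg
    intro i
    rw [Real.norm_eq_abs, abs_of_nonneg (min_nonneg_of hA hM (le_of_lt hg) i)]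
    exact min_le_right _ _
  have h := tendsto_tsum_of_dominated_convergence hsum hlim hbd
  have h0 : (fun i => min (A i * 0) (M i)) = fun _ => (0 : ℝ) := by
    funext i
    rw [mul_zero]
    exact min_eq_left (hM i)
  rw [h0, tsum_zero] at h
  exact h

/-- **THE TERMWISE-TO-SUM STEP**: a convergent sum whose terms obey BOTH bounds is bounded by `ω`. [folklore] -/
theorem abs_tsum_le_omegaMin {A M : ι → ℝ} {I : ι → ℝ} {g : ℝ} (hsum : Summable M)
    (hIM : ∀ i, |I i| ≤ M i) (hIA : ∀ i, |I i| ≤ A i * g) : |∑' i, I i| ≤ omegaMin A M g := by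
  have hIs : Summable (fun i => |I i|) := hsum.of_nonneg_of_le (fun i => abs_nonneg _) hIM
  have hIn : Summable (fun i => ‖I i‖) := by simpa [Real.norm_eq_abs] using hIs
  have hmin : Summable (fun i => min (A i * g) (M i)) :=
    hsum.of_nonneg_of_le (fun i => (abs_nonneg _).trans (le_min (hIA i) (hIM i))) (fun i => min_le_right _ _)
  calc |∑' i, I i| = ‖∑' i, I i‖ := (Real.norm_eq_abs _).symm
    _ ≤ ∑' i, ‖I i‖ := norm_tsum_le_tsum_norm hIn
    _ = ∑' i, |I i| := by simp [Real.norm_eq_abs]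
    _ ≤ omegaMin A M g := hIs.tsum_le_tsum (fun i => le_min (hIA i) (hIM i)) hmin

/-! ## §1 S-MOD — THE modulus letter (critic's text VERBATIM) and THE ONE socket at the record; ★∕★★ roads BY NAME; κ⋆-pinned variants -/

/-- **`RunModulus β b γ₀` — the plain run-wise MODULUS letter**, VERBATIM the text of `Crit2Idea5g8Probe.lean` :32 (= the conclusion shape of g8's
`runModulus_of_runDominatedSplit`; slot convention `k ≤ n` = that of the tree's `RunConstRemainder`): ONE function `ω → 0` at `0⁺` bounds
`|β_{k+1}(g_0,…,g_k) − b_k|` by `ω(g_k)` at every prefix of every in-window run of (0.20).  Hypothesis SHAPE; [I] Thm 2's β-function input with a modulus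
in place of a rate; NOT printed. [cite: Balaban1987RG1, Thm 3 p.264 and (2.13) p.268] -/
def RunModulus (β : HBeta) (b : ℕ → ℝ) (γ₀ : ℝ) : Prop :=
  ∃ ω : ℝ → ℝ, Tendsto ω (𝓝[>] 0) (𝓝 0) ∧
    ∀ n gs, RGEqH n β gs → Step.InInterval γ₀ n gs → ∀ k, k ≤ n → |β k (prefixOf gs k) - b k| ≤ ω (gs k)

/-- The modulus letter restricts to lower levels. [folklore] -/
theorem runModulus_mono {β : HBeta} {b : ℕ → ℝ} {γ₀ γ₁ : ℝ} (h : RunModulus β b γ₀) (hle : γ₁ ≤ γ₀) : RunModulus β b γ₁ := by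
  obtain ⟨ω, hω, hrun⟩ := h
  exact ⟨ω, hω, fun n gs hrg hI k hk => hrun n gs hrg (fun j hj => ⟨(hI j hj).1, (hI j hj).2.trans hle⟩) k hk⟩

/-- **MODULUS ⟹ CONSTANT REMAINDER WITH ANY CAP (proved; = g8 `runConstRemainder_of_runModulus` on the named letter)**: for EVERY `s > 0` there is a
level `0 < γ₁ ≤ γ₀` with `RunConstRemainder β b s γ₁` — no seam between print's frozen constant and the consumer's cap. [folklore] -/
theorem runConstRemainder_of_runModulus {β : HBeta} {b : ℕ → ℝ} {γ₀ : ℝ} (h : RunModulus β b γ₀) (hγ₀ : 0 < γ₀) {s : ℝ}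
    (hs : 0 < s) : ∃ γ₁ : ℝ, 0 < γ₁ ∧ γ₁ ≤ γ₀ ∧ RunConstRemainder β b s γ₁ := by
  obtain ⟨ω, hω, hrun⟩ := h
  have hev : ∀ᶠ g in 𝓝[>] (0 : ℝ), ω g < s := (tendsto_order.1 hω).2 s hs
  obtain ⟨u, hu, hsub⟩ := mem_nhdsGT_iff_exists_Ioo_subset.1 hev
  have hu0 : (0 : ℝ) < u := hu
  refine ⟨min γ₀ (u / 2), lt_min hγ₀ (half_pos hu0), min_le_left _ _, ?_⟩
  intro n gs hrg hI k hk
  have hI₀ : Step.InInterval γ₀ n gs := fun j hj => ⟨(hI j hj).1, (hI j hj).2.trans (min_le_left _ _)⟩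
  have hmem : gs k ∈ Set.Ioo 0 u :=
    ⟨(hI k hk).1, lt_of_le_of_lt ((hI k hk).2.trans (min_le_right _ _)) (half_lt_self hu0)⟩
  have hlt : ω (gs k) < s := hsub hmem
  exact (hrun n gs hrg hI₀ k hk).trans hlt.le

/-- **S-MOD ∕ (MS) THE ONE SOCKET TEXT (hypothesis shape) — «modulus at the anchoring named jets»**, keyed exactly as v6 (κ after θ, normalisation `θ.cβ`
carried, anchor as HYPOTHESIS, run-keyed, full crux prefix): for every colour datum whose scaled named one-loop numbers ANCHOR the record's β, the
remainder obeys `RunModulus` on some window `]0, γ₀]`, `γ₀ ≤ θ.γ`.  The text to register ONCE for every 2ᴮ″ modulus supplier (CRIT-2 T1 (a)); this card,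
`peel-two-threshold-modulus` ed.2 and `convex-fibre-witten-modulus-kappa3` ed.2.3 are three suppliers of it.  Never a fact. [cite: Balaban1987RG1, Thm 2 p.259 (first sentence) and (2.13) p.268] -/
def ModulusAtAnchoredJets13 : Prop :=
  ∀ (F : T4Family) (κ : StepColourData) (θ : Node00.Stage13HParams F 2) (hP : θ.Provisos₁₃SepCoPH F 2),
    (θ.ZhUnity F 2 ∧ θ.SlotsNondegenerate₁₃ F 2) → θ.Admissible F 2 →
    B16.EndStatementBPrinted (Node00.datumOfRecord₁₃SepCoPH F 2 θ hP).C → Window13 F θ hP →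
    ScaleAnchor (Node00.datumOfRecord₁₃SepCoPH F 2 θ hP).βfun (fun k => θ.cβ * beta0OfJs F κ k) →
    ∃ γ₀ : ℝ, 0 < γ₀ ∧ γ₀ ≤ θ.γ ∧
      RunModulus (Node00.datumOfRecord₁₃SepCoPH F 2 θ hP).βfun (fun k => θ.cβ * beta0OfJs F κ k) γ₀

/-- **(AS) THE ANCHOR + SURVIVOR-CONTINUITY TEXT (hypothesis shape; verbatim g8 ∕ the N17 road's `hAS`)** — SOME colour datum anchors the record's β
scale by scale, and (C) holds on the survivor sets at every level `≤ θ.γ`.  Shared with the N17∕corner roads; not this card's object. [folklore] -/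
def AnchorSurvSomeJets13 : Prop :=
  ∀ (F : T4Family) (θ : Node00.Stage13HParams F 2) (hP : θ.Provisos₁₃SepCoPH F 2),
    (θ.ZhUnity F 2 ∧ θ.SlotsNondegenerate₁₃ F 2) → θ.Admissible F 2 →
    B16.EndStatementBPrinted (Node00.datumOfRecord₁₃SepCoPH F 2 θ hP).C → Window13 F θ hP →
    ∃ κ : StepColourData, ScaleAnchor (Node00.datumOfRecord₁₃SepCoPH F 2 θ hP).βfun (fun k => θ.cβ * beta0OfJs F κ k) ∧
      ∀ γ₀ : ℝ, 0 < γ₀ → γ₀ ≤ θ.γ → SurvCont (Node00.datumOfRecord₁₃SepCoPH F 2 θ hP).βfun γ₀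

/-- **★ S-MOD + (AS) ⟹ THE REGISTERED STUB TEXT 2ᴮ″ `RunRemAtSomeJets` BY NAME (proved, no sorry).**  Per tuple: κ and the anchor from (AS); the
modulus at that κ from S-MOD; `runConstRemainder_of_runModulus` with the cap `s := θ.cβ·stepBal 2 F.L` itself (`0 < θ.cβ` from admissibility,
`stepBal_L_pos`) at some `γ₁ ≤ γ₀ ≤ θ.γ`; (C) at `γ₁` from (AS).  CONDITIONAL on the two displayed texts. [cite: Balaban1987RG1, Thm 2 p.259 (first sentence) and (2.13) p.268] -/
theorem runRemAtSomeJets_of_modulus_anchorSurv (hMS : ModulusAtAnchoredJets13) (hAS : AnchorSurvSomeJets13) :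
    RunRemAtSomeJets := by
  intro F θ hP hU hθ hB hwin
  obtain ⟨κ, hanch, hsc⟩ := hAS F θ hP hU hθ hB hwin
  obtain ⟨γ₀, hγ₀, hγθ, hmod⟩ := hMS F κ θ hP hU hθ hB hwin hanch
  have hc : 0 < θ.cβ := hθ.toStage9.chart.1
  have hs : 0 < θ.cβ * B12Normalization.stepBal 2 F.L := mul_pos hc (stepBal_L_pos F two_pos)
  obtain ⟨γ₁, hγ₁, hγ₁₀, hrem⟩ := runConstRemainder_of_runModulus hmod hγ₀ hs
  exact ⟨κ, γ₁, θ.cβ * B12Normalization.stepBal 2 F.L, hγ₁, hγ₁₀.trans hγθ, le_rfl, hrem, hanch,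
    hsc γ₁ hγ₁ (hγ₁₀.trans hγθ)⟩

/-- **★★ (D1) 1ᴬ + S-MOD + (AS) ⟹ THE CRUX DECL BY NAME** through the tree's `EndpointGivenBR13SepCoPH_of_stubTexts` (p603331).  CONDITIONAL on three
displayed hypothesis texts; K2⁷ NOT closed. [cite: Balaban1987RG1, Thm 2 p.259 (first sentence)] -/
theorem EndpointGivenBR13SepCoPH_of_d1_modulus_anchorSurv (h₁ : D1AtAnchoredJets) (hMS : ModulusAtAnchoredJets13)
    (hAS : AnchorSurvSomeJets13) : Summit.QuantumFields.YangMills.Theses.BalabanUVNodes.EndpointGivenBR13SepCoPH :=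
  EndpointGivenBR13SepCoPH_of_stubTexts h₁ (runRemAtSomeJets_of_modulus_anchorSurv hMS hAS)

/-- **S-MODₚ (κ⋆-PINNED socket, hypothesis shape)** — the modulus letter at the PINNED named jets `κ F.L` under the crux prefix (CRIT-2 ROUND 4 re-deal (b);
tree `K2V6Defs` v1.1 §4). [folklore] -/
def ModulusAtPin13 (κ : ℕ → StepColourData) : Prop :=
  ∀ (F : T4Family) (θ : Node00.Stage13HParams F 2) (hP : θ.Provisos₁₃SepCoPH F 2),
    (θ.ZhUnity F 2 ∧ θ.SlotsNondegenerate₁₃ F 2) → θ.Admissible F 2 →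
    B16.EndStatementBPrinted (Node00.datumOfRecord₁₃SepCoPH F 2 θ hP).C → Window13 F θ hP →
    ∃ γ₀ : ℝ, 0 < γ₀ ∧ γ₀ ≤ θ.γ ∧
      RunModulus (Node00.datumOfRecord₁₃SepCoPH F 2 θ hP).βfun (fun k => θ.cβ * beta0OfJs F (κ F.L) k) γ₀

/-- **(AS)ₚ (κ⋆-PINNED anchor + (C), hypothesis shape)** — the pinned scaled numbers anchor the record and (C) holds at every level `≤ θ.γ`. [folklore] -/
def AnchorSurvAtPin13 (κ : ℕ → StepColourData) : Prop :=
  ∀ (F : T4Family) (θ : Node00.Stage13HParams F 2) (hP : θ.Provisos₁₃SepCoPH F 2),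
    (θ.ZhUnity F 2 ∧ θ.SlotsNondegenerate₁₃ F 2) → θ.Admissible F 2 →
    B16.EndStatementBPrinted (Node00.datumOfRecord₁₃SepCoPH F 2 θ hP).C → Window13 F θ hP →
    ScaleAnchor (Node00.datumOfRecord₁₃SepCoPH F 2 θ hP).βfun (fun k => θ.cβ * beta0OfJs F (κ F.L) k) ∧
      ∀ γ₀ : ℝ, 0 < γ₀ → γ₀ ≤ θ.γ → SurvCont (Node00.datumOfRecord₁₃SepCoPH F 2 θ hP).βfun γ₀

/-- **★ₚ pinned S-MOD + pinned (AS) ⟹ the PINNED run letter `RunRemAt F (κ F.L) θ hP θ.cβ` under the crux prefix** (= the `hRun` hypothesis of the tree's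
`EndpointGivenBR13SepCoPH_of_pin`; proved). [cite: Balaban1987RG1, Thm 2 p.259 (first sentence) and (2.13) p.268] -/
theorem runRemAt_pin_of_modulus_anchorSurv (κ : ℕ → StepColourData) (hMS : ModulusAtPin13 κ) (hAS : AnchorSurvAtPin13 κ) :
    ∀ (F : T4Family) (θ : Node00.Stage13HParams F 2) (hP : θ.Provisos₁₃SepCoPH F 2), (θ.ZhUnity F 2 ∧ θ.SlotsNondegenerate₁₃ F 2) →
      θ.Admissible F 2 → B16.EndStatementBPrinted (Node00.datumOfRecord₁₃SepCoPH F 2 θ hP).C → Window13 F θ hP →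
      RunRemAt F (κ F.L) θ hP θ.cβ := by
  intro F θ hP hU hθ hB hwin
  obtain ⟨hanch, hsc⟩ := hAS F θ hP hU hθ hB hwin
  obtain ⟨γ₀, hγ₀, hγθ, hmod⟩ := hMS F θ hP hU hθ hB hwin
  have hc : 0 < θ.cβ := hθ.toStage9.chart.1
  have hs : 0 < θ.cβ * B12Normalization.stepBal 2 F.L := mul_pos hc (stepBal_L_pos F two_pos)
  obtain ⟨γ₁, hγ₁, hγ₁₀, hrem⟩ := runConstRemainder_of_runModulus hmod hγ₀ hs
  exact ⟨γ₁, θ.cβ * B12Normalization.stepBal 2 F.L, hγ₁, hγ₁₀.trans hγθ, le_rfl, hrem, hanch, hsc γ₁ hγ₁ (hγ₁₀.trans hγθ)⟩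

/-- **★★ₚ θ-free pinned (D1) + pinned S-MOD + pinned (AS) ⟹ THE CRUX DECL BY NAME** through the tree's `EndpointGivenBR13SepCoPH_of_pin` (p606356 §4).
CONDITIONAL on the displayed texts; no pin chosen here; K2⁷ NOT closed. [cite: Balaban1987RG1, Thm 2 p.259 (first sentence)] -/
theorem EndpointGivenBR13SepCoPH_of_pin_modulus (κ : ℕ → StepColourData)
    (hD1 : ∀ F : T4Family, ∃ A : ℝ, OneLoopDrift (B12Normalization.stepBal 2 F.L) A (beta0OfJs F (κ F.L)))
    (hMS : ModulusAtPin13 κ) (hAS : AnchorSurvAtPin13 κ) :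
    Summit.QuantumFields.YangMills.Theses.BalabanUVNodes.EndpointGivenBR13SepCoPH :=
  EndpointGivenBR13SepCoPH_of_pin κ hD1 (runRemAt_pin_of_modulus_anchorSurv κ hMS hAS)

/-! ## §2 THE PINNED INTERFACE — an activity representation over the k-FREE index of ℤ⁴-localization domains; S-LIN as a property OF IT -/

/-- **The index (CF4): unit-lattice localization domains of ℤ⁴** — print's `𝐃_{k+1}` AFTER the thermodynamic limit T ↗ ℤ⁴ ([I] (5.1), p. 264 «This limit
exists by the localized representation (1.7)»), a domain being recorded by the finite set of unit-lattice sites of a union of M-cubes.  k-FREE and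
volume-FREE (unlike the torus-indexed `(Sn n).Dom` of `RemainderChain.PolLeaves`), countable: Tannery-ready. [cite: Balaban1987RG1, (1.7) p.261 and (5.1) p.292] -/
abbrev LocDomainZ4 : Type := Finset (Fin 4 → ℤ)

/-- **`ActivityRepr β b γ₀` — a PINNED activity representation of the remainder (interface; the D-REPR deliverable's fibre).**  Along every in-window run,
at every prefix, `β_{k+1}(g_0,…,g_k) − b_k = Σ_X I X k (g_0,…,g_k)` (`HasSum` over `LocDomainZ4`) with the FROZEN, k-, history- and coupling-free
SUMMABLE majorants `|I X| ≤ M X` ([II] Lemma 3 (2.38) p. 20 + tree sum + cube sum, tree `RemainderChain` (L1)–(L3)).  The terms `I` and the majorants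
`M` are FIELDS: a statement about `R : ActivityRepr …` speaks of THAT family.  Intended record instance: §4. [cite: Balaban1988RG2Cluster, Lemma 3 (2.38) p.20; Balaban1987RG1, (2.13) p.268] -/
structure ActivityRepr (β : HBeta) (b : ℕ → ℝ) (γ₀ : ℝ) where
  /-- the X-localized term of the remainder at scale k as a function of the history `(g_0,…,g_k)` -/
  I : LocDomainZ4 → (k : ℕ) → (Fin (k + 1) → ℝ) → ℝ
  /-- the frozen majorant of the X-term -/
  M : LocDomainZ4 → ℝ
  M_nonneg : ∀ X, 0 ≤ M X
  M_summable : Summable M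
  hasSum_run : ∀ (n : ℕ) (gs : ℕ → ℝ), RGEqH n β gs → Step.InInterval γ₀ n gs → ∀ k, k ≤ n →
    HasSum (fun X => I X k (prefixOf gs k)) (β k (prefixOf gs k) - b k)
  frozen_run : ∀ (n : ℕ) (gs : ℕ → ℝ), RGEqH n β gs → Step.InInterval γ₀ n gs → ∀ k, k ≤ n →
    ∀ X, |I X k (prefixOf gs k)| ≤ M X

/-- **S-LIN `LinOnRuns R` (hypothesis shape ABOUT A GIVEN representation)** — every term of `R` vanishes LINEARLY in the running coupling along the runs,
`|I X k (g_0,…,g_k)| ≤ A X · g_k`, with per-domain constants `A X` that are k- and history-free but carry NO decay and NO summability in `X`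
(the card's «crude vanishing majorant»; [I] p. 268 «the expression under the exponential above vanishes at g_k = 0»; [II] p. 8 L23–25 «use g_k|B|
instead of ε₁»; the one-block instance is desk-checked in `DESK-CF1-two-bound-idea5g9.md`). [cite: Balaban1987RG1, (2.13) p.268; Balaban1988RG2Cluster, p.8] -/
def LinOnRuns {β : HBeta} {b : ℕ → ℝ} {γ₀ : ℝ} (R : ActivityRepr β b γ₀) : Prop :=
  ∃ A : LocDomainZ4 → ℝ, (∀ X, 0 ≤ A X) ∧
    ∀ (n : ℕ) (gs : ℕ → ℝ), RGEqH n β gs → Step.InInterval γ₀ n gs → ∀ k, k ≤ n →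
      ∀ X, |R.I X k (prefixOf gs k)| ≤ A X * gs k

/-- **S-REPR's shape clause (hypothesis shape): the frozen majorants are the `RemainderChain` constants** — `M X ≤ A_rem(c) · e^{−κ′ d(X)} · w(X)` with
`A_rem = remActivity c = O(1)·C₃·ε₁` ((2.41) before R23, tree (L1)), `d` = print's `d_{k+1}(X)` on the unit lattice, `w` = the polarization weight of the
second-moment functional (`(4/α₂²)·B₃²·Σ_z |z|² e^{−δ₀(dist(0,X)+dist(z,X))}`, (4.5) p. 282 + (4.35) p. 290). [cite: Balaban1988RG2Cluster, (2.41) p.21; Balaban1987RG1, (4.35) p.290] -/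
def ChainDominated {β : HBeta} {b : ℕ → ℝ} {γ₀ : ℝ} (R : ActivityRepr β b γ₀) (c : B13.Consts) (κ' : ℝ)
    (d w : LocDomainZ4 → ℝ) : Prop :=
  ∀ X, R.M X ≤ remActivity c * Real.exp (-(κ' * d X)) * w X

/-- **S-LIN ⟹ S-MOD at letter level (proved, Tannery)**: on ANY pinned representation, termwise linear vanishing gives the run-wise modulus
`ω(g) = Σ'_X min(A X · g, M X)` — no rate, no `Σ A X`, no `C₃′`. [folklore] -/
theorem runModulus_of_linOnRuns {β : HBeta} {b : ℕ → ℝ} {γ₀ : ℝ} (R : ActivityRepr β b γ₀) (h : LinOnRuns R) :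
    RunModulus β b γ₀ := by
  obtain ⟨A, hA, hlin⟩ := h
  refine ⟨omegaMin A R.M, tendsto_omegaMin hA R.M_nonneg R.M_summable, ?_⟩
  intro n gs hrg hI k hk
  rw [← (R.hasSum_run n gs hrg hI k hk).tsum_eq]
  exact abs_tsum_le_omegaMin R.M_summable (fun X => R.frozen_run n gs hrg hI k hk X) (fun X => hlin n gs hrg hI k hk X)

/-! ### Anti-costume: on a PINNED family S-LIN is NOT implied by the modulus (contrast CRIT-2's `runDominatedSplit_of_runModulus` for the ∃-family) -/

/-- Witness terms: `+√g_k` on the domain `∅`, `−√g_k` on the domain `{0}`, zero elsewhere. [folklore] -/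
def wI : LocDomainZ4 → (k : ℕ) → (Fin (k + 1) → ℝ) → ℝ := fun X k p =>
  if X = ∅ then Real.sqrt (p (Fin.last k)) else if X = {0} then -Real.sqrt (p (Fin.last k)) else 0

/-- Witness majorants: `1` on the two domains `∅`, `{0}`, zero elsewhere. [folklore] -/
def wM : LocDomainZ4 → ℝ := fun X => if X = ∅ ∨ X = {0} then 1 else 0

theorem empty_ne_zero4 : (∅ : LocDomainZ4) ≠ ({0} : LocDomainZ4) := (Finset.singleton_ne_empty _).symm

theorem wI_empty (k : ℕ) (p : Fin (k + 1) → ℝ) : wI ∅ k p = Real.sqrt (p (Fin.last k)) := by simp [wI]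

theorem wI_zero (k : ℕ) (p : Fin (k + 1) → ℝ) : wI {0} k p = -Real.sqrt (p (Fin.last k)) := by
  simp [wI, empty_ne_zero4.symm]

theorem wI_other {X : LocDomainZ4} (h₁ : X ≠ ∅) (h₂ : X ≠ {0}) (k : ℕ) (p : Fin (k + 1) → ℝ) : wI X k p = 0 := by
  simp [wI, h₁, h₂]

/-- The witness representation of the ZERO remainder (`β ≡ 0`, `b ≡ 0`) on the window `]0,1]`. [folklore] -/
def witnessRepr : ActivityRepr (fun _ _ => 0) (fun _ => 0) 1 where
  I := wI
  M := wM
  M_nonneg X := by unfold wM; split_ifs <;> norm_num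
  M_summable := by
    refine summable_of_ne_finset_zero (s := ({∅, {0}} : Finset LocDomainZ4)) ?_
    intro X hX
    simp only [Finset.mem_insert, Finset.mem_singleton, not_or] at hX
    simp [wM, hX.1, hX.2]
  hasSum_run n gs hrg hI k hk := by
    have hsupp : ∀ X ∉ ({∅, {0}} : Finset LocDomainZ4), wI X k (prefixOf gs k) = 0 := by
      intro X hX
      simp only [Finset.mem_insert, Finset.mem_singleton, not_or] at hX
      exact wI_other hX.1 hX.2 k _
    have h : HasSum (fun X => wI X k (prefixOf gs k))
        (∑ X ∈ ({∅, {0}} : Finset LocDomainZ4), wI X k (prefixOf gs k)) := hasSum_sum_of_ne_finset_zero hsupp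
    rw [Finset.sum_pair empty_ne_zero4, wI_empty, wI_zero] at h
    simpa using h
  frozen_run n gs hrg hI k hk X := by
    have hg : 0 < gs k ∧ gs k ≤ 1 := hI k hk
    have hs : Real.sqrt (gs k) ≤ 1 := by
      have := Real.sqrt_le_sqrt hg.2
      simpa using this
    by_cases h₁ : X = ∅
    · subst h₁
      rw [wI_empty]
      simp only [prefixOf_apply, Fin.val_last, wM, true_or, if_true]
      rw [abs_of_nonneg (Real.sqrt_nonneg _)]
      exact hs
    by_cases h₂ : X = {0}
    · subst h₂
      rw [wI_zero]
      simp only [prefixOf_apply, Fin.val_last, wM, or_true, if_true, abs_neg]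
      rw [abs_of_nonneg (Real.sqrt_nonneg _)]
      exact hs
    · rw [wI_other h₁ h₂]
      simp only [abs_zero]
      unfold wM; split_ifs <;> norm_num

/-- **ANTI-COSTUME (proved)**: there is a PINNED representation on whose window the modulus letter holds (trivially: remainder ≡ 0, `ω ≡ 0`) while S-LIN
FAILS for it (the `±√g_k` terms do not vanish linearly).  So `LinOnRuns R` for a NAMED `R` is NOT a consequence of `RunModulus` — unlike the ∃-family
letter of g8, which CRIT-2's `runDominatedSplit_of_runModulus` recovers from the modulus alone. [folklore] -/
theorem exists_repr_modulus_not_lin :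
    ∃ (β : HBeta) (b : ℕ → ℝ) (R : ActivityRepr β b 1), RunModulus β b 1 ∧ ¬ LinOnRuns R := by
  refine ⟨fun _ _ => 0, fun _ => 0, witnessRepr, ⟨fun _ => 0, tendsto_const_nhds, ?_⟩, ?_⟩
  · intro n gs _ _ k _
    simp
  · rintro ⟨A, hA, hlin⟩
    have ha0 : 0 ≤ A ∅ := hA ∅
    obtain ⟨t, ht⟩ : ∃ t : ℝ, t = 1 / (2 * (A ∅ + 1)) := ⟨_, rfl⟩
    have htpos : 0 < t := by rw [ht]; positivity
    have ht1 : t ≤ 1 := by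
      rw [ht, div_le_one (by positivity)]; linarith
    have hrg : RGEqH 0 (fun _ _ => (0 : ℝ)) (fun _ => t ^ 2) := fun k hk => absurd hk (Nat.not_lt_zero _)
    have hI : Step.InInterval 1 0 (fun _ => t ^ 2) := fun k _ => ⟨by positivity, pow_le_one₀ htpos.le ht1⟩
    have h := hlin 0 (fun _ => t ^ 2) hrg hI 0 le_rfl ∅
    have hval : witnessRepr.I ∅ 0 (prefixOf (fun _ => t ^ 2) 0) = t := by
      show wI ∅ 0 (prefixOf (fun _ => t ^ 2) 0) = t
      rw [wI_empty]
      simp only [prefixOf_apply]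
      exact Real.sqrt_sq htpos.le
    rw [hval, abs_of_pos htpos] at h
    -- h : t ≤ A ∅ · t²  ⇒  1 ≤ A ∅ · t; but A ∅ · t = A ∅ ∕ (2(A ∅ + 1)) < 1
    have e : A ∅ * (fun _ : ℕ => t ^ 2) 0 = (A ∅ * t) * t := by
      show A ∅ * t ^ 2 = A ∅ * t * t
      ring
    have h' : t ≤ (A ∅ * t) * t := h.trans e.le
    have h1 : 1 ≤ A ∅ * t := (le_mul_iff_one_le_left htpos).1 h'
    have h2 : A ∅ * t < 1 := by
      rw [ht, mul_one_div, div_lt_one (by positivity)]; linarith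
    linarith

/-! ## §4 THE RECORD-LEVEL TYPE of the D-REPR deliverable, S-LIN at the record, and the roads BY NAME -/

/-- **`RecordRepr13` — THE TYPE of the definer-first deliverable D-REPR (`activityReprOfRecord₁₃`, debt h1; NOT constructed here).**  For every tuple
under the crux prefix and every ANCHORING colour datum κ (V2: a representation with vanishing terms exists only where the θ.cβ-scaled named numbers ARE
the record's one-loop numbers scale by scale — `ScaleAnchor` as hypothesis, same κ as (AS); tree `ScaleAnchor.eq_of_smul`), a window `γ₀ ≤ θ.γ` and an
`ActivityRepr` of the record's β against `θ.cβ · beta0OfJs F κ`.  INTENDED INHABITANT (print, [I] (1.20)–(1.22) p. 264 + (2.12)–(2.15) p. 268, (4.5) p. 282,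
(5.1) p. 292): `I X k hist := −(normalisation)·Σ_z z_μ z_ν · ∂²𝐄_∞^{(k+1)}(X; U(h·z-twist))|₀` = the X-term of the localized LIMIT polarization second moment, where
`𝐄^{(k+1)}(X)` is the (2.13)-activity of [II] §2 (Mayer logarithm of the `H(Z)`, (2.12)–(2.13) p. 14–15) transported to ℤ⁴ termwise; `M X` of shape
`ChainDominated` (tree `RemainderChain`). [cite: Balaban1987RG1, (1.22) p.264 and (2.13) p.268; Balaban1988RG2Cluster, (2.13) p.15] -/
structure RecordRepr13 where
  /-- the window of the representation at a tuple and an anchoring colour datum -/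
  γ₀ : (F : T4Family) → StepColourData → (θ : Node00.Stage13HParams F 2) → θ.Provisos₁₃SepCoPH F 2 → ℝ
  γ₀_pos : ∀ F κ θ hP, 0 < γ₀ F κ θ hP
  γ₀_le : ∀ F κ θ hP, γ₀ F κ θ hP ≤ θ.γ
  /-- the representation itself, available under the crux prefix AND the anchor hypothesis at κ -/
  repr : ∀ (F : T4Family) (κ : StepColourData) (θ : Node00.Stage13HParams F 2) (hP : θ.Provisos₁₃SepCoPH F 2),
    (θ.ZhUnity F 2 ∧ θ.SlotsNondegenerate₁₃ F 2) → θ.Admissible F 2 →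
    B16.EndStatementBPrinted (Node00.datumOfRecord₁₃SepCoPH F 2 θ hP).C → Window13 F θ hP →
    ScaleAnchor (Node00.datumOfRecord₁₃SepCoPH F 2 θ hP).βfun (fun k => θ.cβ * beta0OfJs F κ k) →
    ActivityRepr (Node00.datumOfRecord₁₃SepCoPH F 2 θ hP).βfun (fun k => θ.cβ * beta0OfJs F κ k) (γ₀ F κ θ hP)

/-- **S-LIN AT THE RECORD (hypothesis shape ABOUT a given `𝓡 : RecordRepr13`)**: every representation `𝓡` delivers obeys `LinOnRuns`.  The stub a line
would register is `LinAtAnchoredJets13 activityReprOfRecord₁₃` — AFTER D-REPR lands; with `𝓡` existential it would be the modulus stub renamed (T1). [cite: Balaban1987RG1, (2.13) p.268; Balaban1988RG2Cluster, p.8 and (1.38)–(1.40) p.10] -/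
def LinAtAnchoredJets13 (𝓡 : RecordRepr13) : Prop :=
  ∀ (F : T4Family) (κ : StepColourData) (θ : Node00.Stage13HParams F 2) (hP : θ.Provisos₁₃SepCoPH F 2)
    (hU : θ.ZhUnity F 2 ∧ θ.SlotsNondegenerate₁₃ F 2) (hθ : θ.Admissible F 2)
    (hB : B16.EndStatementBPrinted (Node00.datumOfRecord₁₃SepCoPH F 2 θ hP).C) (hwin : Window13 F θ hP)
    (hanch : ScaleAnchor (Node00.datumOfRecord₁₃SepCoPH F 2 θ hP).βfun (fun k => θ.cβ * beta0OfJs F κ k)),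
    LinOnRuns (𝓡.repr F κ θ hP hU hθ hB hwin hanch)

/-- **S-LIN at the record ⟹ S-MOD (proved)** — for ANY delivered `𝓡`. [folklore] -/
theorem modulusAtAnchoredJets13_of_lin (𝓡 : RecordRepr13) (h : LinAtAnchoredJets13 𝓡) : ModulusAtAnchoredJets13 := by
  intro F κ θ hP hU hθ hB hwin hanch
  exact ⟨𝓡.γ₀ F κ θ hP, 𝓡.γ₀_pos F κ θ hP, 𝓡.γ₀_le F κ θ hP,
    runModulus_of_linOnRuns (𝓡.repr F κ θ hP hU hθ hB hwin hanch) (h F κ θ hP hU hθ hB hwin hanch)⟩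

/-- **★★★ (D1) 1ᴬ + S-LIN(𝓡) + (AS) ⟹ THE CRUX DECL BY NAME (proved, no sorry)** — the card's whole chain over the tree's v6 texts:
S-LIN ⟹ S-MOD (Tannery) ⟹ with (AS) the registered 2ᴮ″ text ⟹ with 1ᴬ the crux (`EndpointGivenBR13SepCoPH_of_stubTexts`).  CONDITIONAL on the displayed
hypothesis texts and on a delivered `𝓡`; nothing of Bałaban asserted; K2⁷ NOT closed. [cite: Balaban1987RG1, Thm 2 p.259 (first sentence) and (2.13) p.268] -/
theorem EndpointGivenBR13SepCoPH_of_d1_lin_anchorSurv (𝓡 : RecordRepr13) (h₁ : D1AtAnchoredJets) (hL : LinAtAnchoredJets13 𝓡)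
    (hAS : AnchorSurvSomeJets13) : Summit.QuantumFields.YangMills.Theses.BalabanUVNodes.EndpointGivenBR13SepCoPH :=
  EndpointGivenBR13SepCoPH_of_d1_modulus_anchorSurv h₁ (modulusAtAnchoredJets13_of_lin 𝓡 hL) hAS

end Summit.QuantumFields.YangMills.Cruxes.EndpointGivenBR13SepCoPH.Idea5g9
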